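import Summits.BirchSwinnertonDyer.BirchSwinnertonDyer.Theorems.AlignedTransportAtTwoMainConjectureOfRankZeroBSDAtTwoHalfDescentBaseIndexLocal
import HarnessLib

/-!
# Route `AlignedTransportAtTwo`, crux C2 `MainConjectureOfRankZeroBSDAtTwo` (stmt-BirchSwinnertonDyer-22298):
# THE BASE TERM CARRIES `p^μ`, IX — THE LOCAL `μ`-BOUND, EXPLICIT AWAY FROM `p`: for EVERY elliptic curve over EVERY number field, every `p`, every `ℤ_p`-extension and every finite `S ⊇ {v ∣ p} ∪ {bad v}`:
# `#ker g_0 ≤ ∏_{v∈S, v∣p} #𝒦_{v,0}[p^∞] · ∏_{v∈S, v∤p} max(4, p^{v_p(ord_v Δ_min)})`, hence `μ(X(E/K_∞)) ≤ log_p(#Sel_{p^∞}(E/K) · that product)` — only the places above `p` keep an unevaluated factor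

HONEST FRAMING (cell `bsd-f1-sign2`, WIDTH-5 attached prover seat `bsd-line-att-p5` gen 60 on line `birth` of the lead `bsd-line-att-p2`;
`--supports` stmt-BirchSwinnertonDyer-22298, closes nothing; BSD is NOT proved by any of this; the crux C2, its verdict «blocked-on
`Rank1Residual.GreenbergMuConjectureIrreducible`» and every registered stub (P / T / Kμ / LimDoor / MuIneqʳ / PFμ⁺) are untouched). THEOREMS ONLY — no `def`,
no instance, no named fact, no `sorry`. Route-independent. Sequel of `…BaseIndexLocal` (`#ker g_0 ≤ ∏_{v∈S} #𝒦_{v,0}[p^∞]`, `μ ≤ log_p(#Sel·∏#𝒦)`) with the tree's EXPLICIT form of Greenberg's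
Lemma 3.3 at every layer (`WeierstrassCurve.finite_and_natCard_localTowerKerPrimary_le_of_not_mem`: for `v ∤ p`, `#𝒦_{v,n}[p^∞] ≤ max 4 (p^{v_p(ord_v Δ_min)})` — good ⇒ `0`, multiplicative ⇒
`∣ p^{v_p(ord_v Δ_min)}`, additive ⇒ `≤ 4`). So away from `p` every local factor is a NUMBER read off the minimal discriminant; at `v ∣ p` the factor `#𝒦_{v,0}[p^∞]` stays displayed
(Lemma 3.4: `= #Ẽ(k_v)[p^∞]²` at good ordinary `v` — a named PRINT fact in the tree at every `p`, `Greenberg1999.lemma34_natCard_localTowerKerPrimary_eq_rat`; finite, kernel-proved, over `ℚ`).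

* ★★★ `natCard_kerG_zero_le_prod_explicit`: **`#ker g_0 ≤ ∏_{v∈S} b_v`**, `b_v = #𝒦_{v,0}[p^∞]` if `v ∣ p`, `b_v = max 4 (p^{v_p(ord_v Δ_min)})` if `v ∤ p` (`S ⊇ {v∣p} ∪ bad`, `𝒦_{v,0}[p^∞]` finite at `v ∣ p`).
* ★★★ `mu_le_log_explicit`: **`p^{μ} ≤ #Sel_{p^∞}(E/K) · ∏_{v∈S} b_v`** and **`μ(X(E/K_∞)) ≤ log_p(#Sel_{p^∞}(E/K) · ∏_{v∈S} b_v)`** when `Sel_{p^∞}(E/K)` is finite.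
* ★★★ `mu_le_log_explicit_rat`: over `ℚ` at a good ORDINARY `p` (ANY `p`), `κ` cyclotomic, `W` globally minimal: the same with the finiteness at `p` discharged by the tree.
Reading for C2 (`p = 2`, seed): `μ₂(W) ≤ v₂#Ш(W)[2^∞] + v₂#𝒦_{2,0}[2^∞] + Σ_{ℓ ∣ N} log₂ max(4, 2^{v₂(ord_ℓ Δ)})` — every term except the `2`-adic kernel is a base invariant of `W`; `#𝒦_{2,0}[2^∞] = #W̃(𝔽₂)[2^∞]² ∈ {4,16}`
in print. Nothing numerical is asserted; C2 untouched. Memo `Cruxes/MainConjectureOfRankZeroBSDAtTwo/BASE-TERM-att-p5-g60.md`.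

References: R. Greenberg, LNM 1716 (1999), §3 Lemmas 3.3–3.5 (pp. 86–90), §4 Thm. 4.1, Lemma 4.4 [GreenbergLNM1716]; J. Silverman, AEC, VII.5.1, VII.6.1 [SilvermanAEC2009].
-/

set_option linter.dupNamespace false
set_option autoImplicit false

noncomputable section

open scoped Classical Polynomial

namespace Summit.BirchSwinnertonDyer.BirchSwinnertonDyer.Theorems.AlignedTransportAtTwoHalfDescentBaseIndexLocalExplicit

open NumberField IsDedekindDomain WeierstrassCurve Literature.NumberTheory.EllipticCurves Literature.NumberTheory.GaloisRepresentations
  Literature.NumberTheory.EllipticCurves.IwasawaAlgebra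
  Summit.BirchSwinnertonDyer.Rank1Residual.X1.MuLambda
  Summit.BirchSwinnertonDyer.Rank1Residual.Iwasawa
  Summit.BirchSwinnertonDyer.BirchSwinnertonDyer.Theorems.AlignedTransportAtTwoHalfDescentBaseIndexSelmer
  Summit.BirchSwinnertonDyer.BirchSwinnertonDyer.Theorems.AlignedTransportAtTwoHalfDescentBaseIndexLocal

section AnyField

-- `K : Type` (universe `0`): forced by the tree's multiplicative local kernel theorem behind `finite_and_natCard_localTowerKerPrimary_le_of_not_mem`
variable {K : Type} [Field K] [NumberField K] (W : WeierstrassCurve K) [W.IsElliptic] {p : ℕ} [hp : Fact p.Prime] (κ : ZpExtension K p)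
  {γ : Field.absoluteGaloisGroup K}

/-- ★★★ **`#ker g_0 ≤ ∏_{v∈S} b_v` with `b_v = #𝒦_{v,0}[p^∞]` at `v ∣ p` and `b_v = max 4 (p^{v_p(ord_v Δ_min)})` at `v ∤ p`** — `E/K` elliptic, ANY `p`, ANY `ℤ_p`-extension, any finite `S` containing
every place above `p` or of bad reduction, `𝒦_{v,0}[p^∞]` finite at the places of `S` above `p`. [cite: GreenbergLNM1716, §3 Lemmas 3.3–3.5 (pp. 86–90)] [cite: SilvermanAEC2009, VII.5.1] -/
theorem natCard_kerG_zero_le_prod_explicit (S : Finset (HeightOneSpectrum (𝓞 K)))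
    (hS : ∀ v : HeightOneSpectrum (𝓞 K), (p : 𝓞 K) ∈ v.asIdeal ∨ ¬ W.HasGoodReductionAt v → v ∈ S)
    (hfinP : ∀ v ∈ S, (p : 𝓞 K) ∈ v.asIdeal → Finite (W.localTowerKerPrimary κ (v.adicCompletion K) 0)) :
    Finite (W.KerG κ 0) ∧ Nat.card (W.KerG κ 0) ≤
      ∏ v ∈ S, (if (p : 𝓞 K) ∈ v.asIdeal then Nat.card (W.localTowerKerPrimary κ (v.adicCompletion K) 0) else max 4 (p ^ padicValNat p (W.ordMinimalDiscriminant v))) := by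
  obtain ⟨hfin, hle⟩ := finite_kerG_zero_and_card_le_prod_of_finite_atP W κ S hS hfinP
  refine ⟨hfin, hle.trans (Finset.prod_le_prod (fun v _ ↦ Nat.zero_le _) fun v _ ↦ ?_)⟩
  split_ifs with hpv
  · exact le_rfl
  · exact (W.finite_and_natCard_localTowerKerPrimary_le_of_not_mem κ hpv 0).2

/-- ★★★ **`p^{μ(X(E/K_∞))} ≤ #Sel_{p^∞}(E/K) · ∏_{v∈S} b_v` and `μ ≤ log_p(#Sel_{p^∞}(E/K) · ∏_{v∈S} b_v)`** (`b_v` as above) whenever `Sel_{p^∞}(E/K)` is finite — `E/K` elliptic, any `p`, any `ℤ_p`-extension with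
topological generator `γ`, any Pontryagin-dual datum with `X` f.g. torsion; the only unevaluated factors are the `𝒦_{v,0}[p^∞]` at `v ∣ p`.
[cite: GreenbergLNM1716, Conj. 1.11, §3 Lemmas 3.3–3.5, §4 Thm. 4.1, Lemmas 4.3–4.4] -/
theorem mu_le_log_explicit (hγ : κ.IsTopGenerator γ) (D : W.SelmerDualData κ γ) [Module.Finite (IwasawaAlgebra p) D.X] (hD : D.IsTorsion)
    (S : Finset (HeightOneSpectrum (𝓞 K))) (hS : ∀ v : HeightOneSpectrum (𝓞 K), (p : 𝓞 K) ∈ v.asIdeal ∨ ¬ W.HasGoodReductionAt v → v ∈ S)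
    (hfinP : ∀ v ∈ S, (p : 𝓞 K) ∈ v.asIdeal → Finite (W.localTowerKerPrimary κ (v.adicCompletion K) 0)) [Finite ↥(W.selmerLayer κ 0)] :
    p ^ D.mu ≤ Nat.card ↥(W.selmerLayer κ 0) *
        ∏ v ∈ S, (if (p : 𝓞 K) ∈ v.asIdeal then Nat.card (W.localTowerKerPrimary κ (v.adicCompletion K) 0) else max 4 (p ^ padicValNat p (W.ordMinimalDiscriminant v))) ∧
      D.mu ≤ Nat.log p (Nat.card ↥(W.selmerLayer κ 0) *
        ∏ v ∈ S, (if (p : 𝓞 K) ∈ v.asIdeal then Nat.card (W.localTowerKerPrimary κ (v.adicCompletion K) 0) else max 4 (p ^ padicValNat p (W.ordMinimalDiscriminant v)))) := by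
  obtain ⟨hfin, hle⟩ := natCard_kerG_zero_le_prod_explicit W κ S hS hfinP
  haveI := hfin
  have hdvd := pow_mu_dvd_natCard_selmerLayer_zero_mul_kerG_zero W κ hγ D hD
  have h1 := (Nat.le_of_dvd (Nat.mul_pos Nat.card_pos Nat.card_pos) hdvd).trans (Nat.mul_le_mul_left _ hle)
  exact ⟨h1, Nat.le_log_of_pow_le hp.out.one_lt h1⟩

end AnyField

section Rat

variable (W : WeierstrassCurve ℚ) [W.IsElliptic] [W.IsGloballyMinimal] {p : ℕ} [hp : Fact p.Prime] (κ : ZpExtension ℚ p) {γ : Field.absoluteGaloisGroup ℚ}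

/-- ★★★ **Over `ℚ` at a good ORDINARY prime `p` (ANY `p`), `κ` cyclotomic with topological generator `γ`, `W` globally minimal, `Sel_{p^∞}(W/ℚ)` finite, any torsion dual datum, any finite
`S ⊇ {p} ∪ {bad}`: `μ(X(W/ℚ_∞)) ≤ log_p(#Sel_{p^∞}(W/ℚ) · #𝒦_{p,0}[p^∞] · ∏_{ℓ∈S, ℓ≠p} max(4, p^{v_p(ord_ℓ Δ)}))`** (written as one product with the `if`); the factor at `p` is finite by the tree
(Lemma 3.4 at the base) and equals `#W̃(𝔽_p)[p^∞]²` in print. [cite: GreenbergLNM1716, §3 Lemmas 3.3–3.4, §4 Thm. 4.1, Lemma 4.4] -/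
theorem mu_le_log_explicit_rat (hgood : W.HasGoodReductionAtPrime p) (hord : ¬ (p : ℤ) ∣ W.frobeniusTrace p) (hκ : κ.IsCyclotomic) (hγ : κ.IsTopGenerator γ)
    (D : W.SelmerDualData κ γ) (hD : D.IsTorsion) (S : Finset (HeightOneSpectrum (𝓞 ℚ)))
    (hS : ∀ v : HeightOneSpectrum (𝓞 ℚ), (p : 𝓞 ℚ) ∈ v.asIdeal ∨ ¬ W.HasGoodReductionAt v → v ∈ S) [Finite ↥(W.selmerLayer κ 0)] :
    D.mu ≤ Nat.log p (Nat.card ↥(W.selmerLayer κ 0) *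
      ∏ v ∈ S, (if (p : 𝓞 ℚ) ∈ v.asIdeal then Nat.card (W.localTowerKerPrimary κ (v.adicCompletion ℚ) 0) else max 4 (p ^ padicValNat p (W.ordMinimalDiscriminant v)))) := by
  haveI : Module.Finite (IwasawaAlgebra p) D.X := D.module_finite_holds hγ
  have hΔ : ¬ (p : ℤ) ∣ minimalDiscriminantInt W := W.not_dvd_minimalDiscriminantInt_of_hasGoodReductionAtPrime' p hgood
  exact (mu_le_log_explicit W κ hγ D hD S hS (fun v _ hpv ↦ W.finite_localTowerKerPrimary_zero_of_ordinary hpv hΔ hord κ hκ)).2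

end Rat

end Summit.BirchSwinnertonDyer.BirchSwinnertonDyer.Theorems.AlignedTransportAtTwoHalfDescentBaseIndexLocalExplicit

end
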